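import Literature.AlgebraicGeometry.Motives.TateAbelianFiniteOfFiniteness
import HarnessLib

/-!
# Tate's Main Theorem over a finite field from Milne 1986 Cor. 18.9 in all dimensions (global form)

J. Tate, *Endomorphisms of abelian varieties over finite fields*, Invent. Math. 2 (1966),
Main Theorem — the named facts `tate_bijective_of_finite A B ℓ` (`Hom` form) and
`tate_end_bijective_of_finite A ℓ` (`End` form) of `Motives/TateAbelianFinite`.

The ONE-hypothesis forms of Tate's theorem — from `finite_isoClasses_of_finite K (dim (A ⊞ B))`
(Milne 1986, Cor. 18.9) alone, or from Tate's hypothesis (∞-iso) within the isogeny class of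
`A ⊞ B` alone, the Theorem of the Cube and Poincaré's complete reducibility theorem over `K̄` being
theorems of the tree — live in `Motives/TateAbelianFiniteOfFiniteness`
(`tate_[end_]bijective_of_finite_of_finite_isoClasses_of_finite`,
`tate_[end_]bijective_of_finite_of_exists_infinite_iso_alone`); the unconditional semisimplicity of
`End⁰` (Mumford §19 Cor. 2 over `K̄`, Tate 1966 §1 over a finite field) lives in
`Motives/AbelianVarietyEndAlgebraSemisimple`. This file only adds the global form
`forall_tate_bijective_of_finite_of_finite_isoClasses`: granted Milne 1986 Cor. 18.9 in every
dimension over the field `K`, both forms of Tate's theorem hold for all abelian varieties over `K`.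
Hence `tate_end_bijective_of_finite_holds` is
`tate_end_bijective_of_finite_of_finite_isoClasses_of_finite A ℓ (finite_isoClasses_of_finite_holds K _)`
once that fact lands. No definition and no named fact is introduced (D-0026).

## References

* [Tate1966Endomorphisms] J. Tate, *Endomorphisms of abelian varieties over finite fields*,
  Invent. Math. 2 (1966), 134–144, Main Theorem — not held (doi:10.1007/bf01404549); statement as
  reported in Milne, *The Work of John Tate*, §4.3 (arXiv:1210.7459, held, p. 22).
* [Milne1986AbelianVarieties] J. S. Milne, *Abelian Varieties*, in Cornell–Silverman (1986),
  Cor. 18.9 (held, PDF p. 212).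
-/

noncomputable section

universe u

open CategoryTheory CategoryTheory.Limits AlgebraicGeometry

namespace Literature.AlgebraicGeometry.Motives

open AbelianVariety

/-- **Tate 1966, Main Theorem over a finite field, both forms and all abelian varieties over `K`,
from Milne 1986 Cor. 18.9 in all dimensions** (`tate_bijective_of_finite_of_finite_isoClasses_of_finite`,
`tate_end_bijective_of_finite_of_finite_isoClasses_of_finite` of `Motives/TateAbelianFiniteOfFiniteness`).
[cite: Tate1966Endomorphisms, Main Theorem] -/
theorem forall_tate_bijective_of_finite_of_finite_isoClasses {K : Type u} [Field K]
    (ℓ : ℕ) [Fact ℓ.Prime] (hfin : ∀ g : ℕ, finite_isoClasses_of_finite K g) :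
    (∀ A B : AbelianVariety K, tate_bijective_of_finite A B ℓ) ∧
      ∀ A : AbelianVariety K, tate_end_bijective_of_finite A ℓ :=
  ⟨fun A B => tate_bijective_of_finite_of_finite_isoClasses_of_finite A B ℓ (hfin _),
    fun A => tate_end_bijective_of_finite_of_finite_isoClasses_of_finite A ℓ (hfin _)⟩

end Literature.AlgebraicGeometry.Motives
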